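import Literature.Analysis.Asymptotics.LaplaceMethodCompactGroup
import Literature.MathematicalPhysics.QuantumFieldTheory.Balaban1983to89.LogChartProduct
import HarnessLib

/-!
# The Laplace method on a PRODUCT of compact groups `G^B` (lattice gauge configuration space over a finite bond set):
# Gibbs ∕ Wilson-type measures `e^{−βf} Π_b dU(b) ∕ Z_β` concentrate at a unique minimum that is non-degenerate in the
# product exponential coordinates `U(b) = U₀(b)·exp A(b)`

Topic `Literature/Analysis/Asymptotics`; sequel of `LaplaceMethodCompactGroup.lean` (`tendsto_laplaceMethod_haar`,
`tendsto_gibbs_expectation_haar` on ONE compact group faithfully represented) through the product log-chart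
`Balaban1983to89.LogChartProduct` (`piLogChart`, `isChartRep_pi`: `G^B` is itself a compact group faithfully represented
on `𝔸^B`, with componentwise exponential chart `expChart_pi_apply`).  Everything here is PROVED; no definitions, no named
facts.

RESULTS (namespace `Literature.Analysis.Asymptotics`), for `h : IsChartRep C ρ` (e.g. `SU(N)`, `U(N)`, every closed
`G ≤ U(N)`), a finite bond set `B`, ANY Haar measure `μB` on `B → G` (e.g. `Measure.pi (fun _ => μ)`, Mathlib
`Measure.pi.isHaarMeasure`), a Euclidean frame `e : W ≃L[ℝ] 𝔤^B` of the product Lie algebra, `f : (B → G) → ℝ`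
continuous with a UNIQUE minimiser `U₀` and the second-order expansion
`f(U₀ · (b ↦ Θ((e v)(b)))) = f(U₀) + ½⟪Av, v⟫ + o(‖v‖²)` (`A` symmetric positive definite on `W`), `φ` continuous:
* ★★ `tendsto_gibbs_expectation_haar_pi`: `∫ e^{−βf} φ dμB ∕ ∫ e^{−βf} dμB ⟶ φ(U₀)` (`β → ∞`) — constant-free;
* ★ `tendsto_laplaceMethod_haar_pi`: `β^{d/2} ∫ e^{−β(f − f U₀)} φ dμB ⟶ (2π)^{d/2}(det A)^{−1/2}·σ₀^B(e)·φ(U₀)`,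
  `d = dim 𝔤^B = #B · dim 𝔤`, `σ₀^B(e)` the window constant of the product chart (Helgason's (13) for `G^B`);
* `tendsto_gibbs_expectation_haar_pi_specialUnitaryGroup` — `SU(N)^B`, every rank.
Typical consumer: a lattice gauge theory on a CONTRACTIBLE region in a complete axial gauge (the gauge-fixed Wilson action
has the unique minimum `U ≡ 1`, non-degenerate because `H¹ = 0`; cell `ym-ir` row 46 O1 «open-cube anchor» at tree
level), or any finite-lattice spin ∕ gauge model whose classical minimum is unique after symmetry fixing.  What is NOT here:
Morse–Bott over gauge orbits (use `tendsto_laplaceMethod_fibred_chart` + a slice), β-UNIFORM spectral statements.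

HONEST FRAMING: classical finite-dimensional semiclassics (`β → ∞` on a FIXED finite lattice); width 0 by itself toward
any infinite-volume or uniform statement (T1-box, O1, IRcof, THE NUMBER); the Yang–Mills mass gap (Clay) is NOT touched;
`R4` closes only `BalabanLadder.UV`.

## References
* S. Helgason, *Groups and Geometric Analysis*, AMS (2000), Ch. I §1 Thm 1.14 (13) p. 96. [Helgason2000]
* K. W. Breitung, *Asymptotic Approximations for Probability Integrals*, LNM 1592 (1994), Thm 41 p. 56. [Breitung1994]
* C.-R. Hwang, *Laplace's method revisited: weak convergence of probability measures*, Ann. Probab. 8 (1980)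
  1177–1182. [Hwang1980]
* T. Bałaban, Commun. Math. Phys. **102** (1985) 255–275, (18) p. 260 (product Haar measure over a bond set in exponential
  coordinates). [Balaban1985UV3]
-/

noncomputable section

open _root_.MeasureTheory _root_.Filter _root_.Set _root_.Module _root_.Topology
open scoped _root_.Real _root_.InnerProductSpace _root_.ENNReal _root_.NNReal
open Literature.MathematicalPhysics.QuantumFieldTheory.Balaban1983to89
open Literature.MathematicalPhysics.QuantumFieldTheory.Balaban1983to89.HaarExponentialChart
open Literature.MathematicalPhysics.QuantumFieldTheory.Balaban1983to89.LogChartProduct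

namespace Literature.Analysis.Asymptotics

variable {𝔸 : Type*} [NormedRing 𝔸] [NormedAlgebra ℂ 𝔸] [CompleteSpace 𝔸]
variable {G : Type*} [Group G] [TopologicalSpace G] [IsTopologicalGroup G] [CompactSpace G]
  [MeasurableSpace G] [BorelSpace G] [SecondCountableTopology G]
variable {C : LogChart 𝔸} {ρ : G →* 𝔸} (h : IsChartRep C ρ) [FiniteDimensional ℝ C.lie]
  (hlie : ∀ x ∈ C.lie, ∀ y ∈ C.lie, x * y - y * x ∈ C.lie)
variable (B : Type*) [Fintype B]
variable [MeasurableSpace (piLogChart C B).lie] [BorelSpace (piLogChart C B).lie]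
variable (μB : Measure (B → G)) [μB.IsHaarMeasure]
variable {W : Type*} [NormedAddCommGroup W] [InnerProductSpace ℝ W] [FiniteDimensional ℝ W]
  [MeasurableSpace W] [BorelSpace W] (e : W ≃L[ℝ] (piLogChart C B).lie)

/-! ## §1 Laplace ∕ Gibbs concentration on `G^B` -/

section Pi

include hlie in
/-- **Gibbs measures on `G^B` concentrate at a unique non-degenerate minimum — constant-free form.**  For a compact group
`G` faithfully represented (`h : IsChartRep C ρ`), a finite bond set `B`, any Haar measure `μB` on `B → G` (e.g. the
product `Measure.pi (fun _ => μ)` of Haar measures), a Euclidean frame `e : W ≃L[ℝ] 𝔤^B`, `f : (B → G) → ℝ` continuous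
with a unique minimiser `U₀` and `f(U₀ · (b ↦ Θ((e v) b))) = f(U₀) + ½⟪Av,v⟫ + o(‖v‖²)` (`A` symmetric positive
definite), and `φ` continuous:  `∫ e^{−βf} φ dμB ∕ ∫ e^{−βf} dμB ⟶ φ(U₀)` as `β → ∞`.
[cite: Helgason2000, Ch. I §1 Thm 1.14 (13) p. 96] [cite: Breitung1994, Thm 41 (5.24) p. 56]
[cite: Hwang1980, main theorem (one-point minimum set)] [cite: Balaban1985UV3, (18) p. 260] -/
theorem tendsto_gibbs_expectation_haar_pi {f φ : (B → G) → ℝ} {U₀ : B → G} {A : W →ₗ[ℝ] W}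
    (hA : A.IsSymmetric) (hpos : ∀ y, y ≠ 0 → 0 < ⟪A y, y⟫_ℝ)
    (hf : Continuous f) (hφ : Continuous φ) (hmin : ∀ U, U ≠ U₀ → f U₀ < f U)
    (hS2 : (fun v => f (U₀ * fun b => h.expChart (lieApply C B (e v) b)) - f U₀ - (1 / 2) * ⟪A v, v⟫_ℝ)
      =o[𝓝 0] fun v => ‖v‖ ^ 2) :
    Tendsto (fun β : ℝ => (∫ U, Real.exp (-β * f U) * φ U ∂μB) / ∫ U, Real.exp (-β * f U) ∂μB) atTop
      (𝓝 (φ U₀)) := by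
  haveI := finiteDimensional_piLogChart_lie C B
  have hfun : (fun v => f (U₀ * (isChartRep_pi B h).expChart (e v)) - f U₀ - (1 / 2) * ⟪A v, v⟫_ℝ) =
      fun v => f (U₀ * fun b => h.expChart (lieApply C B (e v) b)) - f U₀ - (1 / 2) * ⟪A v, v⟫_ℝ := by
    funext v
    rw [expChart_pi_eq B h (e v)]
  have hS2' : (fun v => f (U₀ * (isChartRep_pi B h).expChart (e v)) - f U₀ - (1 / 2) * ⟪A v, v⟫_ℝ)
      =o[𝓝 0] fun v => ‖v‖ ^ 2 := by
    rw [hfun]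
    exact hS2
  exact tendsto_gibbs_expectation_haar (isChartRep_pi B h) (lie_adStable_pi C B hlie) μB e hA hpos hf hφ hmin hS2'

/-- **Laplace's method on `G^B`, with the constant**: under the same hypotheses,
`β^{d/2} ∫ e^{−β(f − f(U₀))} φ dμB ⟶ (2π)^{d/2}(det A)^{−1/2}·σ₀^B(e)·φ(U₀)`, `d = dim W = #B·dim 𝔤`, where `σ₀^B(e)` is the
window constant of the product chart (Helgason's (13) for the compact group `G^B` in the frame `e`).
[cite: Helgason2000, Ch. I §1 Thm 1.14 (13) p. 96] [cite: Breitung1994, Thm 41 (5.24) p. 56]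
[cite: Balaban1985UV3, (18) p. 260] -/
theorem tendsto_laplaceMethod_haar_pi {f φ : (B → G) → ℝ} {U₀ : B → G} {A : W →ₗ[ℝ] W}
    (hA : A.IsSymmetric) (hpos : ∀ y, y ≠ 0 → 0 < ⟪A y, y⟫_ℝ)
    (hf : Continuous f) (hφ : Continuous φ) (hmin : ∀ U, U ≠ U₀ → f U₀ < f U)
    (hS2 : (fun v => f (U₀ * fun b => h.expChart (lieApply C B (e v) b)) - f U₀ - (1 / 2) * ⟪A v, v⟫_ℝ)
      =o[𝓝 0] fun v => ‖v‖ ^ 2) :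
    haveI := finiteDimensional_piLogChart_lie C B
    Tendsto (fun β : ℝ => β ^ ((finrank ℝ W : ℝ) / 2) * ∫ U, Real.exp (-β * (f U - f U₀)) * φ U ∂μB) atTop
      (𝓝 ((2 * π) ^ ((finrank ℝ W : ℝ) / 2) / Real.sqrt (LinearMap.det A) *
        ((μB ((isChartRep_pi B h).window (IsChartRep.chartRadius (piLogChart C B))) /
            (isChartRep_pi B h).chartMeasure (lie_adStable_pi C B hlie) ((volume : Measure W).map e)
              (IsChartRep.chartRadius (piLogChart C B))
              ((isChartRep_pi B h).window (IsChartRep.chartRadius (piLogChart C B)))).toReal * φ U₀))) := by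
  haveI := finiteDimensional_piLogChart_lie C B
  have hfun : (fun v => f (U₀ * (isChartRep_pi B h).expChart (e v)) - f U₀ - (1 / 2) * ⟪A v, v⟫_ℝ) =
      fun v => f (U₀ * fun b => h.expChart (lieApply C B (e v) b)) - f U₀ - (1 / 2) * ⟪A v, v⟫_ℝ := by
    funext v
    rw [expChart_pi_eq B h (e v)]
  have hS2' : (fun v => f (U₀ * (isChartRep_pi B h).expChart (e v)) - f U₀ - (1 / 2) * ⟪A v, v⟫_ℝ)
      =o[𝓝 0] fun v => ‖v‖ ^ 2 := by
    rw [hfun]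
    exact hS2
  exact tendsto_laplaceMethod_haar (isChartRep_pi B h) (lie_adStable_pi C B hlie) μB e hA hpos hf hφ hmin hS2'

end Pi

/-! ## §2 `SU(N)^B`, every rank -/

section SpecialUnitary

open scoped Matrix.Norms.L2Operator
open Literature.MathematicalPhysics.QuantumLattice (fundamentalRep)

variable {n : Type*} [Fintype n] [DecidableEq n] [Nonempty n]
variable {B' : Type*} [Fintype B']
variable {W' : Type*} [NormedAddCommGroup W'] [InnerProductSpace ℝ W'] [FiniteDimensional ℝ W']
  [MeasurableSpace W'] [BorelSpace W']

/-- **`SU(N)^B`, every rank: Gibbs ∕ Wilson-type measures `e^{−βf} dμB ∕ Z_β` (any Haar measure `μB` on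
`B → SU(N)`, e.g. `Measure.pi (fun _ => haarProbability SU(N))`) concentrate at a unique minimiser `U₀` that is
non-degenerate in the product exponential coordinates `U(b) = U₀(b)·exp A(b)`:  `∫ e^{−βf} φ dμB ∕ ∫ e^{−βf} dμB ⟶ φ(U₀)`.**
Here `Θ = (isChartRep_specialUnitaryGroup).expChart : 𝔰𝔲(N) → SU(N)` (`↑(Θ X) = exp X`), `e : W ≃L[ℝ] 𝔰𝔲(N)^B` any frame.
[cite: Helgason2000, Ch. I §1 Thm 1.14 (13) p. 96] [cite: Breitung1994, Thm 41 (5.24) p. 56]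
[cite: Hwang1980, main theorem (one-point minimum set)] [cite: Balaban1985UV3, (18) p. 260] -/
theorem tendsto_gibbs_expectation_haar_pi_specialUnitaryGroup
    [MeasurableSpace (piLogChart (specialUnitaryLogChart n) B').lie]
    [BorelSpace (piLogChart (specialUnitaryLogChart n) B').lie]
    (μB : Measure (B' → Matrix.specialUnitaryGroup n ℂ)) [μB.IsHaarMeasure]
    (e : W' ≃L[ℝ] (piLogChart (specialUnitaryLogChart n) B').lie)
    {f φ : (B' → Matrix.specialUnitaryGroup n ℂ) → ℝ} {U₀ : B' → Matrix.specialUnitaryGroup n ℂ} {A : W' →ₗ[ℝ] W'}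
    (hA : A.IsSymmetric) (hpos : ∀ y, y ≠ 0 → 0 < ⟪A y, y⟫_ℝ)
    (hf : Continuous f) (hφ : Continuous φ) (hmin : ∀ U, U ≠ U₀ → f U₀ < f U)
    (hS2 : (fun v => f (U₀ * fun b => (isChartRep_specialUnitaryGroup (n := n)).expChart
        (lieApply (specialUnitaryLogChart n) B' (e v) b)) - f U₀ - (1 / 2) * ⟪A v, v⟫_ℝ) =o[𝓝 0] fun v => ‖v‖ ^ 2) :
    Tendsto (fun β : ℝ => (∫ U, Real.exp (-β * f U) * φ U ∂μB) / ∫ U, Real.exp (-β * f U) ∂μB) atTop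
      (𝓝 (φ U₀)) :=
  haveI := (isChartRep_specialUnitaryGroup (n := n)).secondCountableTopology
  tendsto_gibbs_expectation_haar_pi (isChartRep_specialUnitaryGroup (n := n))
    (lie_adStable_specialUnitaryGroup (n := n)) B' μB e hA hpos hf hφ hmin hS2

end SpecialUnitary

end Literature.Analysis.Asymptotics
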